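import Summits.KontsevichZagierPeriods.KontsevichZagierPeriods.Theorems.LinRedNormalFormArrangementNormalFormStubRebaseSimplePosOneFibreParNear
import Summits.KontsevichZagierPeriods.KontsevichZagierPeriods.Theorems.LinRedNormalFormArrangementNormalFormStubRebaseSimplePosOneFibreParPole

/-!
# Stub `stub_rebaseSimplePosOne`, residual hypothesis `Hpar` (crux `ArrangementNormalForm`,
line `janus-bands`, v6.2) — sub-part `ParNonpinch`

**Parallel bands over a NON-PINCHING PRODUCT cell, both sides of the pole.** The two thin
sub-cases (B1) (`rebaseSimplePos_par_thin_exchange`: pole `ℓ₂` on the far side of the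
`y`-range) and (B2) (`rebaseSimplePos_par_thin_near`: pole on the near side) are assembled under
the POINTWISE fact that the pole `ℓ₂(x')` never lies strictly inside the `y`-range
`(ylo(x'), yhi(x'))` of the product cell (`RebasePos.pole_outside`, sub-part `ParPole`: forced by
absolute convergence unless the `x'`-factor vanishes identically, in which case the datum is a
relation). Over a CONVEX cell with non-degenerate `y`-range this pointwise exclusion is ONE-SIDED
(`RebasePos.pole_one_side`: along a segment the affine functions `ℓ₂ − ylo`, `ℓ₂ − yhi` cannot
change side without `ℓ₂` entering the range), and the side together with the sign of the common
slope `u_y` selects (B1) or (B2). Registered as `rebaseSimplePos_par_nonpinch`: the residual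
hypothesis `Hpar` over non-pinching product cells, with NO further hypothesis, target
`closure (GGset B 2 1)`. What is left of
`Hpar`: the dissection of a general base cell into product cells (order cells of its `y`-bounds,
rule 1a) and the PINCHING `y`-ranges (`yhi − ylo → 0` on the boundary of the `x'`-cell).

References: M. Kontsevich, D. Zagier, *Periods* (2001), §1.2.
-/

noncomputable section

open Set MeasureTheory MvPolynomial
open Literature.NumberTheory.Transcendental Literature.ModelTheory.ExponentialFields

namespace Summit.KontsevichZagierPeriods.ArrangementNormalForm.JanusBands

namespace RebasePos

open SeparatePos IntegrateOut

section Nonpinch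

variable {B m m' m₀ : ℕ} (L : Fin m → (Fin B → ℚ) × ℚ) (e : Fin m → ℕ) (ℓ₁ ℓ₂ : (Fin B → ℚ) × ℚ)

/-- `x'`-forms along a segment. -/
theorem affB_segment (d : (Fin B → ℚ) × ℚ) (z₁ z₂ : Fin (B + 1 + 1) → ℝ) (t : ℝ) :
    affB B 1 d (fun i => (1 - t) * z₁ i + t * z₂ i) = (1 - t) * affB B 1 d z₁ + t * affB B 1 d z₂ := by
  have h : ∀ i : Fin B, (d.1 i : ℝ) * ((1 - t) * z₁ (Fin.castAdd 1 (Fin.castSucc i)) + t * z₂ (Fin.castAdd 1 (Fin.castSucc i))) =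
      (1 - t) * ((d.1 i : ℝ) * z₁ (Fin.castAdd 1 (Fin.castSucc i))) + t * ((d.1 i : ℝ) * z₂ (Fin.castAdd 1 (Fin.castSucc i))) :=
    fun i => by ring
  simp only [affB, h, Finset.sum_add_distrib, ← Finset.mul_sum]
  ring

/-- **One-sidedness of the pole exclusion over a convex cell.** If on the (convex) `x'`-cell
`{M₀-rows > 0}` the `y`-range `(ylo, yhi)` is non-degenerate and the form `ℓ` never lies strictly
inside it, then `ℓ ≤ ylo` on the whole cell or `yhi ≤ ℓ` on the whole cell. -/
theorem pole_one_side (M₀ : Fin m₀ → (Fin B → ℚ) × ℚ) (ylo yhi ℓ : (Fin B → ℚ) × ℚ)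
    (hne : ∀ z : Fin (B + 1 + 1) → ℝ, (∀ j, 0 < affB B 1 (M₀ j) z) → affB B 1 ylo z < affB B 1 yhi z)
    (hpole : ∀ z : Fin (B + 1 + 1) → ℝ, (∀ j, 0 < affB B 1 (M₀ j) z) →
      affB B 1 ℓ z ≤ affB B 1 ylo z ∨ affB B 1 yhi z ≤ affB B 1 ℓ z) :
    (∀ z : Fin (B + 1 + 1) → ℝ, (∀ j, 0 < affB B 1 (M₀ j) z) → affB B 1 ℓ z ≤ affB B 1 ylo z) ∨
    (∀ z : Fin (B + 1 + 1) → ℝ, (∀ j, 0 < affB B 1 (M₀ j) z) → affB B 1 yhi z ≤ affB B 1 ℓ z) := by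
  by_contra hcon
  push Not at hcon
  obtain ⟨⟨z₁, hz₁, h₁⟩, ⟨z₂, hz₂, h₂⟩⟩ := hcon
  -- at `z₁` the pole is above, at `z₂` it is below
  have h₁' : affB B 1 yhi z₁ ≤ affB B 1 ℓ z₁ := (hpole z₁ hz₁).resolve_left (not_le.2 h₁)
  have h₂' : affB B 1 ℓ z₂ ≤ affB B 1 ylo z₂ := (hpole z₂ hz₂).resolve_right (not_le.2 h₂)
  -- the segment
  set seg : ℝ → (Fin (B + 1 + 1) → ℝ) := fun t i => (1 - t) * z₁ i + t * z₂ i with hseg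
  have hrows : ∀ t ∈ Icc (0 : ℝ) 1, ∀ j, 0 < affB B 1 (M₀ j) (seg t) := by
    intro t ht j
    rw [hseg]
    dsimp only
    rw [affB_segment]
    rcases eq_or_lt_of_le ht.1 with h0 | h0
    · rw [← h0]; simpa using hz₁ j
    rcases eq_or_lt_of_le ht.2 with h1 | h1
    · rw [h1]; simpa using hz₂ j
    · have e1 := mul_pos (sub_pos.2 h1) (hz₁ j)
      have e2 := mul_pos h0 (hz₂ j)
      linarith
  -- `f = ℓ − ylo`, `g = ℓ − yhi` along the segment
  set f₀ := affB B 1 ℓ z₁ - affB B 1 ylo z₁ with hf₀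
  set f₁ := affB B 1 ℓ z₂ - affB B 1 ylo z₂ with hf₁
  set g₀ := affB B 1 ℓ z₁ - affB B 1 yhi z₁ with hg₀
  set g₁ := affB B 1 ℓ z₂ - affB B 1 yhi z₂ with hg₁
  have hf₀p : 0 < f₀ := by rw [hf₀]; linarith
  have hf₁n : f₁ ≤ 0 := by rw [hf₁]; linarith
  have hg₀p : 0 ≤ g₀ := by rw [hg₀]; linarith
  have hg₁n : g₁ < 0 := by rw [hg₁]; linarith
  have hfg₀ : g₀ < f₀ := by rw [hf₀, hg₀]; linarith [hne z₁ hz₁]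
  have hfg₁ : g₁ < f₁ := by rw [hf₁, hg₁]; linarith [hne z₂ hz₂]
  -- the roots
  set tf : ℝ := f₀ / (f₀ - f₁) with htf
  set tg : ℝ := g₀ / (g₀ - g₁) with htg
  have hdf : 0 < f₀ - f₁ := by linarith
  have hdg : 0 < g₀ - g₁ := by linarith
  have htf1 : tf ≤ 1 := by rw [htf, div_le_one hdf]; linarith
  have htg0 : 0 ≤ tg := div_nonneg hg₀p hdg.le
  -- `tg < tf`: at `tg` the function `g` vanishes, so `f > 0` there
  have hlt : tg < tf := by
    rw [htf, htg, div_lt_div_iff₀ hdg hdf]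
    have e1 : g₁ * (f₀ - g₀) < 0 := mul_neg_of_neg_of_pos hg₁n (by linarith)
    have e2 : g₀ * (g₁ - f₁) ≤ 0 := mul_nonpos_of_nonneg_of_nonpos hg₀p (by linarith)
    nlinarith [e1, e2]
  set t : ℝ := (tg + tf) / 2 with ht
  have ht0 : 0 ≤ t := by rw [ht]; linarith
  have ht1 : t ≤ 1 := by rw [ht]; linarith
  have hft : 0 < (1 - t) * f₀ + t * f₁ := by
    have : (1 - t) * f₀ + t * f₁ = (f₀ - f₁) * (tf - t) := by rw [htf]; field_simp; ring
    rw [this]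
    exact mul_pos hdf (by rw [ht]; linarith)
  have hgt : (1 - t) * g₀ + t * g₁ < 0 := by
    have : (1 - t) * g₀ + t * g₁ = (g₀ - g₁) * (tg - t) := by rw [htg]; field_simp; ring
    rw [this]
    exact mul_neg_of_pos_of_neg hdg (by rw [ht]; linarith)
  -- contradiction at `seg t`
  have key := hpole (seg t) (hrows t ⟨ht0, ht1⟩)
  rw [hseg] at key
  dsimp only at key
  rw [affB_segment, affB_segment, affB_segment] at key
  rw [hf₀, hf₁] at hft
  rw [hg₀, hg₁] at hgt
  rcases key with k | k <;> nlinarith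

/-- **Parallel bands over a non-pinching product cell** (both sides of the pole). See the module
docstring. -/
theorem good_parNonpinch (s : KZ.IntegralRep (B + 1 + 1)) (M : Fin m' → (Fin (B + 1) → ℚ) × ℚ)
    (M₀ : Fin m₀ → (Fin B → ℚ) × ℚ) (ylo yhi : (Fin B → ℚ) × ℚ) (p : MvPolynomial (Fin B) ℚ)
    (u v : (Fin (B + 1) → ℚ) × ℚ) (hbd : Bornology.IsBounded s.domain)
    (hdom : s.domain = gDom B 1 m' M (fun _ => Sum.inr u) (fun _ => Sum.inr v))
    (hint : EqOn s.integrand (glit B 1 p L e ℓ₁ ℓ₂ 0 1 (fun _ => some 0)) s.domain)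
    (hu : u.1 (Fin.last B) ≠ 0) (hpar : u.1 (Fin.last B) = v.1 (Fin.last B))
    (hcell : ∀ z : Fin (B + 1 + 1) → ℝ, (∀ j, 0 < affF B 1 (M j) z) → 0 < affF B 1 u z ∧ affF B 1 u z < affF B 1 v z)
    (hsec : ∀ z : Fin (B + 1 + 1) → ℝ, (∀ j, 0 < affF B 1 (M j) z) ↔ ((∀ j, 0 < affB B 1 (M₀ j) z) ∧
      affB B 1 ylo z < z (Fin.castAdd 1 (Fin.last B)) ∧ z (Fin.castAdd 1 (Fin.last B)) < affB B 1 yhi z))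
    (hη : ∃ η : ℝ, 0 < η ∧ ∀ z : Fin (B + 1 + 1) → ℝ, (∀ j, 0 < affB B 1 (M₀ j) z) →
      η ≤ affB B 1 yhi z - affB B 1 ylo z)
    (hpole : ∀ z : Fin (B + 1 + 1) → ℝ, (∀ j, 0 < affB B 1 (M₀ j) z) →
      affB B 1 ℓ₂ z ≤ affB B 1 ylo z ∨ affB B 1 yhi z ≤ affB B 1 ℓ₂ z) :
    ∃ c ∈ AddSubgroup.closure (GGset B 2 1), KZ.of s - c ∈ KZ.relations := by
  obtain ⟨η, hη0, hη'⟩ := hη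
  have hne : ∀ z : Fin (B + 1 + 1) → ℝ, (∀ j, 0 < affB B 1 (M₀ j) z) → affB B 1 ylo z < affB B 1 yhi z :=
    fun z hz => by have := hη' z hz; linarith
  rcases pole_one_side M₀ ylo yhi ℓ₂ hne hpole with hbelow | habove
  · rcases lt_or_gt_of_ne hu with hn | hp
    · -- `s < 0`, pole below the range: (B2)
      exact good_parNear L e ℓ₁ ℓ₂ s M M₀ ylo yhi p u v hbd hdom hint hu hpar hcell hsec ⟨η, hη0, hη'⟩
        fun z hz => ⟨fun h => absurd hn (not_lt.2 h.le), fun _ => hbelow z hz⟩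
    · -- `s > 0`, pole below the range: (B1)
      exact good_parThin L e ℓ₁ ℓ₂ s M M₀ ylo yhi p u v hbd hdom hint hu hpar hcell hsec ⟨η, hη0, hη'⟩
        fun z hz => ⟨fun _ => hbelow z hz, fun h => absurd hp (not_lt.2 h.le)⟩
  · rcases lt_or_gt_of_ne hu with hn | hp
    · -- `s < 0`, pole above the range: (B1)
      exact good_parThin L e ℓ₁ ℓ₂ s M M₀ ylo yhi p u v hbd hdom hint hu hpar hcell hsec ⟨η, hη0, hη'⟩
        fun z hz => ⟨fun h => absurd hn (not_lt.2 h.le), fun _ => habove z hz⟩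
    · -- `s > 0`, pole above the range: (B2)
      exact good_parNear L e ℓ₁ ℓ₂ s M M₀ ylo yhi p u v hbd hdom hint hu hpar hcell hsec ⟨η, hη0, hη'⟩
        fun z hz => ⟨fun _ => habove z hz, fun h => absurd hp (not_lt.2 h.le)⟩

/-- **The residual hypothesis `Hpar` over a non-pinching product cell** (no side condition): if
the `x'`-factor is degenerate (`p = 0`, or `Lⱼ = 0` with `eⱼ ≠ 0`) the integrand vanishes on the
domain and `[s]` is a relation; otherwise `pole_outside` supplies the pole exclusion and
`good_parNonpinch` concludes. -/
theorem good_parNonpinch' (s : KZ.IntegralRep (B + 1 + 1)) (M : Fin m' → (Fin (B + 1) → ℚ) × ℚ)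
    (M₀ : Fin m₀ → (Fin B → ℚ) × ℚ) (ylo yhi : (Fin B → ℚ) × ℚ) (p : MvPolynomial (Fin B) ℚ)
    (u v : (Fin (B + 1) → ℚ) × ℚ) (hbd : Bornology.IsBounded s.domain)
    (hdom : s.domain = gDom B 1 m' M (fun _ => Sum.inr u) (fun _ => Sum.inr v))
    (hint : EqOn s.integrand (glit B 1 p L e ℓ₁ ℓ₂ 0 1 (fun _ => some 0)) s.domain)
    (hu : u.1 (Fin.last B) ≠ 0) (hpar : u.1 (Fin.last B) = v.1 (Fin.last B))
    (hcell : ∀ z : Fin (B + 1 + 1) → ℝ, (∀ j, 0 < affF B 1 (M j) z) → 0 < affF B 1 u z ∧ affF B 1 u z < affF B 1 v z)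
    (hsec : ∀ z : Fin (B + 1 + 1) → ℝ, (∀ j, 0 < affF B 1 (M j) z) ↔ ((∀ j, 0 < affB B 1 (M₀ j) z) ∧
      affB B 1 ylo z < z (Fin.castAdd 1 (Fin.last B)) ∧ z (Fin.castAdd 1 (Fin.last B)) < affB B 1 yhi z))
    (hη : ∃ η : ℝ, 0 < η ∧ ∀ z : Fin (B + 1 + 1) → ℝ, (∀ j, 0 < affB B 1 (M₀ j) z) →
      η ≤ affB B 1 yhi z - affB B 1 ylo z) :
    ∃ c ∈ AddSubgroup.closure (GGset B 2 1), KZ.of s - c ∈ KZ.relations := by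
  by_cases hdeg : p = 0 ∨ ∃ j, e j ≠ 0 ∧ L j = 0
  · -- the integrand vanishes on the domain
    refine ⟨0, zero_mem _, ?_⟩
    rw [sub_zero]
    refine KZ.of_mem_relations_of_eqOn_zero s fun z hz => ?_
    rw [hint hz, Pi.zero_apply, glit_one]
    rcases hdeg with hp | ⟨j, hej, hLj⟩
    · rw [hp, map_zero, zero_div, zero_mul, zero_mul]
    · have h0 : ∏ j, (affB B 1 (L j) z) ^ e j = 0 := by
        refine Finset.prod_eq_zero (Finset.mem_univ j) ?_
        rw [hLj]
        simp [affB, hej]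
      rw [h0, div_zero, zero_mul, zero_mul]
  · push Not at hdeg
    obtain ⟨hp, hL⟩ := hdeg
    exact good_parNonpinch L e ℓ₁ ℓ₂ s M M₀ ylo yhi p u v hbd hdom hint hu hpar hcell hsec hη
      (pole_outside L e ℓ₁ ℓ₂ s M M₀ ylo yhi p u v hdom hint hpar hcell hsec hp fun j hj => hL j hj)

end Nonpinch

end RebasePos

/-- **Registered part of `stub_rebaseSimplePosOne`, residual hypothesis `Hpar` (line
`janus-bands`, v6.2): parallel bands over a NON-PINCHING PRODUCT cell.** The data of `Hpar` (one
lettered fibre over a base of dimension `B + 1`, letter `0`, affine bounds `0 < u < v` parallel in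
`y` with common slope `u_y ≠ 0`, base pole `1/(y − ℓ₂(x'))` of order one), PLUS ONLY: the base
cell is a product `{x'-rows M₀} × (ylo(x'), yhi(x'))` (`hsec`) whose `y`-range is non-pinching
(`hη : yhi − ylo ≥ η > 0`). THEN `[s]` is congruent modulo `KZ.relations` to the subgroup
generated by the literal class `GG B 2 1` (`RebasePos.good_parNonpinch'`: the pole lies outside
the `y`-range by absolute convergence (`pole_outside`), on one side over the convex cell
(`pole_one_side`), and the side with the sign of `u_y` selects the UNFOLD–EXCHANGE chain (B1) or
the dominated partial fractions with re-selection (B2); a degenerate `x'`-factor gives a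
relation). What is left of `Hpar`: the dissection of a general base cell into such product cells
(rule 1a on the order of its `y`-bounds) and the PINCHING `y`-ranges. -/
theorem rebaseSimplePos_par_nonpinch (B m m' m₀ : ℕ) (s : KZ.IntegralRep (B + 1 + 1)) (M : Fin m' → (Fin (B + 1) → ℚ) × ℚ) (M₀ : Fin m₀ → (Fin B → ℚ) × ℚ) (ylo yhi : (Fin B → ℚ) × ℚ) (L : Fin m → (Fin B → ℚ) × ℚ) (e : Fin m → ℕ) (p : MvPolynomial (Fin B) ℚ) (ℓ₁ ℓ₂ : (Fin B → ℚ) × ℚ) (u v : (Fin (B + 1) → ℚ) × ℚ) (hbd : Bornology.IsBounded s.domain) (hdom : s.domain = SeparatePos.gDom B 1 m' M (fun _ => Sum.inr u) (fun _ => Sum.inr v)) (hint : Set.EqOn s.integrand (RebasePos.glit B 1 p L e ℓ₁ ℓ₂ 0 1 (fun _ => some 0)) s.domain) (hu : u.1 (Fin.last B) ≠ 0) (hpar : u.1 (Fin.last B) = v.1 (Fin.last B)) (hcell : ∀ z : Fin (B + 1 + 1) → ℝ, (∀ j, 0 < SeparatePos.affF B 1 (M j) z) → 0 < SeparatePos.affF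 B 1 u z ∧ SeparatePos.affF B 1 u z < SeparatePos.affF B 1 v z) (hsec : ∀ z : Fin (B + 1 + 1) → ℝ, (∀ j, 0 < SeparatePos.affF B 1 (M j) z) ↔ ((∀ j, 0 < SeparatePos.affB B 1 (M₀ j) z) ∧ SeparatePos.affB B 1 ylo z < z (Fin.castAdd 1 (Fin.last B)) ∧ z (Fin.castAdd 1 (Fin.last B)) < SeparatePos.affB B 1 yhi z)) (hη : ∃ η : ℝ, 0 < η ∧ ∀ z : Fin (B + 1 + 1) → ℝ, (∀ j, 0 < SeparatePos.affB B 1 (M₀ j) z) → η ≤ SeparatePos.affB B 1 yhi z - SeparatePos.affB B 1 ylo z) : ∃ c ∈ AddSubgroup.closure (SeparatePos.GGset B 2 1), KZ.of s - c ∈ KZ.relations :=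
  RebasePos.good_parNonpinch' L e ℓ₁ ℓ₂ s M M₀ ylo yhi p u v hbd hdom hint hu hpar hcell hsec hη

end Summit.KontsevichZagierPeriods.ArrangementNormalForm.JanusBands
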